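import Literature.AlgebraicGeometry.Frobenioids.DivisorialDescriptionsIII
import Literature.AnabelianGeometry.EtaleTheta.Discharge.Sec3Thm37Holds
import Literature.AnabelianGeometry.EtaleTheta.BiKummerRoots

/-!
# [EtTh] Theorem 4.4 (i)(ii)(iii): the PRINTED PROOF as intermediate statements (sub-DAG, D-0068 (1))

S. Mochizuki, *The étale theta function …*, Publ. RIMS **45** (2009) [MochizukiEtTh2009], §4, Thm 4.4
"Category-theoreticity of Bi-Kummer Data" (statement PDF pp. 93–94, proof PDF pp. 94–95; printed 319–321).
Statements of record (not restated): `BiKummerSetting.Thm44Hyp`, `Thm44_i`–`Thm44_iv` (`BiKummerRoots.lean`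
v5, owner abc-iut-L2-t3; (iv) ⇐ Prop 4.3 (ii) and (ii) mod three [FrdI] inputs are `Discharge/Sec4Thm44(ii)`).
This file types the printed proof of (i)(ii)(iii) (p.94 l.−6 – p.95 l.22) into NAMED INTERMEDIATE STATEMENTS
(rows `EtTh:Thm4.4(·)/T44-L…` of `plan/L2/SUBDAG-EtTh-Thm44.md`) and proves the steps that are formal over the
present two-field interface:
* "cf. also the existence of `Ψ^bs`" (p.95 l.2) — `Ψ` preserves base-isos / base-identity endomorphisms /
  base-isomorphic and base-equivalent pairs: PROVED from `Thm44Hyp.comm` (`isBaseIso_map`, …).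
* T44-L03 `PreservesFrobeniusStructure` ([FrdI] Thm 3.4 (ii)(iii) INPUT at `Ψ`), T44-L04
  `PreservesBaseFrobeniusPairs` ([FrdI] Cor 5.7 (i)(iv) INPUT), T44-L04b `PreservesBaseFrobeniusTypeData`.
* T44-L05 `PreservesFrobeniusTrivial` — PROVED from T44-L03 (`preservesFrobeniusTrivial_of`).
* T44-L06 = [FrdI] Thm 5.1 (iii), IN THE TREE and PROVED: `PreFrobenioid.thm51iii_iso_of_baseIso`.
* T44-L07 `MapsAodotIsomorphs` (= (i) clause 1) — PROVED from L05, L06, Thm 3.7 (i) "isotropic"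
  (`TemperedFrobenioid.thm37_i_isotropic_holds`) and "`C₂` is a Frobenioid" (`mapsAodotIsomorphs_of`).
* T44-L09 `HodotCompatible` / T44-L09c `GaloisCompatible` — the [SemiAnbd] Prop 3.2 / Thm A.4 INPUT at `Ψ^bs`.
* T44-L08 `PreservesAmple` (= (i) clause 2) — PROVED from L09c (`preservesAmple_of`); (i) ASSEMBLED:
  `thm44_i_of`, `thm44_i_of_inputs`.
* T44-L10 `BiratCompatible` ([FrdI] Cor 4.10 INPUT: `Ψ^birat` vs restriction, fractions, `Aut`-actions),
  T44-L12 `PreservesDisjointSupports` ([FrdI] Thm 4.2 (ii) INPUT), the LEFT-fraction-pair clause of (ii)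
  `Thm44_ii_left` (not rendered by `Thm44_ii`), T44-L14 `PreservesNthRoots` (the clause (iv) consumes, in the
  shape `Thm44_iv` binds).
* T44-L15a `PreservesFixedByHA`, T44-L15b `PreservesNHSaturatedBsFld` ([FrdII] Def 2.2 (ii) / [AbsAnab] Lem 1.3.8
  INPUT), the two directions `PreservesSaturated` / `ReflectsSaturated` of `Thm44_iii` (v5).  The Kummer-class
  clause of (iii) is TODO-merge(abc-iut-L1-t4) upstream.  The (ii)/(iii) COMPOSITIONS (`thm44_ii_of_subnodes`,
  `thm44_ii_left_of`, `preservesFixedByHA_of`, `preservesSaturated_of`, `thm44_iii_of`) are kernel-checked in the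
  proof-only companion `BiKummerThm44SubProofs.lean`.
Every `def` below is a SUB-NODE STATEMENT of a printed proof step (a predicate on `Thm44Hyp` data), never a new
`Prop` FACT (D-0067 (5)).  HONEST FRAMING: refereed pre-IUT material ([EtTh] 2009); nothing here bears on
[IUTchIII] Cor. 3.12; typed ≠ proved.
-/

noncomputable section

namespace Literature.AnabelianGeometry.EtaleTheta

open CategoryTheory Opposite Literature.AlgebraicGeometry.Frobenioids

namespace BiKummerSetting

universe u₀ v₀ u v w

variable {K : Type u₀} [Field K] {K' : Type u₀} [Field K'] {D₀ : Type u₀} [Category.{v₀} D₀]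
  {V : FrdIMonoidStub.{w}}
  {X₁ : SemiGraphs.TemperedArithmeticGroup.{u₀} K} {X₂ : SemiGraphs.TemperedArithmeticGroup.{u₀} K'}
  {D₀' : Type u₀} [Category.{v₀} D₀']
  {T₁ : RealifiedDivisorMonoids (D₀ := D₀) V} {T₂ : RealifiedDivisorMonoids (D₀ := D₀') V}
  {D₁ D₂ : Type u} [Category.{v} D₁] [Category.{v} D₂] {VD₁ : FrdICatStub.{u, v, w} D₁}
  {VD₂ : FrdICatStub.{u, v, w} D₂} {S₁ : BiKummerSetting X₁ T₁ D₁ VD₁} {S₂ : BiKummerSetting X₂ T₂ D₂ VD₂}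

/-! ### "cf. also the existence of `Ψ^bs`" (p.95 l.2): what `Base ∘ Ψ ≅ Ψ^bs ∘ Base` alone transports -/

/-- The comparison isomorphism `c_A : Ψ^bs(A^bs) ≅ (Ψ A)^bs` of `Thm44Hyp.comm`, with its type spelled
objectwise. [cite: MochizukiEtTh2009, Thm 4.4 p.93] -/
def Thm44Hyp.cmp (h : Thm44Hyp S₁ S₂) (A : S₁.C) :
    h.Ψbs.functor.obj (S₁.base.obj A) ≅ S₂.base.obj (h.Ψ.functor.obj A) :=
  h.comm.app A

/-- `Base₂(Ψ φ) = c_A⁻¹ ∘ Ψ^bs(Base₁ φ) ∘ c_B` (naturality of `comm`, objectwise types).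
[cite: MochizukiEtTh2009, Thm 4.4 p.93] -/
theorem Thm44Hyp.base_map_Ψ_cmp (h : Thm44Hyp S₁ S₂) {A B : S₁.C} (φ : A ⟶ B) :
    S₂.base.map (h.Ψ.functor.map φ) = (h.cmp A).inv ≫ h.Ψbs.functor.map (S₁.base.map φ) ≫ (h.cmp B).hom := by
  have hn := h.comm.hom.naturality φ
  simp only [Functor.comp_map] at hn
  have e : (h.comm.app A).inv ≫ (h.Ψbs.functor.map (S₁.base.map φ) ≫ h.comm.hom.app B) =
      S₂.base.map (h.Ψ.functor.map φ) := by
    rw [Iso.inv_comp_eq]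
    exact hn
  exact e.symm

/-- `Ψ` carries base-isomorphisms to base-isomorphisms ([FrdI] Def 1.2 (ii)), through
`Base ∘ Ψ ≅ Ψ^bs ∘ Base`. [cite: MochizukiEtTh2009, Thm 4.4 p.95] -/
theorem Thm44Hyp.isBaseIso_map (h : Thm44Hyp S₁ S₂) {A B : S₁.C} {φ : A ⟶ B}
    (hφ : PreFrobenioid.IsBaseIso S₁.F φ) : PreFrobenioid.IsBaseIso S₂.F (h.Ψ.functor.map φ) := by
  have hφ' : IsIso (S₁.base.map φ) := hφ
  show IsIso (S₂.base.map (h.Ψ.functor.map φ))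
  rw [h.base_map_Ψ_cmp]
  infer_instance

/-- `Ψ` carries base-identity endomorphisms to base-identity endomorphisms ([FrdI] Def 1.2 (ii)).
[cite: MochizukiEtTh2009, Thm 4.4 p.95] -/
theorem Thm44Hyp.isBaseIdentity_map (h : Thm44Hyp S₁ S₂) {A : S₁.C} {φ : A ⟶ A}
    (hφ : S₁.IsBaseIdentity φ) : S₂.IsBaseIdentity (h.Ψ.functor.map φ) := by
  have hφ' : S₁.base.map φ = 𝟙 _ := hφ
  show S₂.base.map (h.Ψ.functor.map φ) = 𝟙 _
  rw [h.base_map_Ψ_cmp, hφ', h.Ψbs.functor.map_id, Category.id_comp, Iso.inv_hom_id]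

/-- `Ψ` carries base-isomorphic pairs of objects to base-isomorphic pairs ([FrdI] Def 1.2 (ii)).
[cite: MochizukiEtTh2009, Thm 4.4 p.95] -/
theorem Thm44Hyp.baseIsomorphic_map (h : Thm44Hyp S₁ S₂) {A B : S₁.C}
    (hAB : PreFrobenioid.BaseIsomorphic S₁.F A B) :
    PreFrobenioid.BaseIsomorphic S₂.F (h.Ψ.functor.obj A) (h.Ψ.functor.obj B) := by
  obtain ⟨e⟩ := hAB
  exact ⟨(h.cmp A).symm ≪≫ h.Ψbs.functor.mapIso e ≪≫ h.cmp B⟩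

/-- The isomorphism `Aut_{D₁}(A^bs) → Aut_{D₂}((Ψ A)^bs)` "induced by `Ψ^bs`" (Thm 4.4 (i)/(iv), p.94):
`σ ↦ c_A⁻¹ ∘ Ψ^bs(σ) ∘ c_A`, as a group homomorphism. [cite: MochizukiEtTh2009, Thm 4.4 p.94] -/
def Thm44Hyp.transportBaseAut (h : Thm44Hyp S₁ S₂) (A : S₁.C) :
    Aut (S₁.base.obj A) →* Aut (S₂.base.obj (h.Ψ.functor.obj A)) :=
  (Aut.autMulEquivOfIso (h.cmp A)).toMonoidHom.comp (h.Ψbs.functor.mapAut (S₁.base.obj A))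

/-- `(transportBaseAut A σ).hom = c_A⁻¹ ≫ Ψ^bs(σ.hom) ≫ c_A`. [cite: MochizukiEtTh2009, Thm 4.4 p.94] -/
theorem Thm44Hyp.transportBaseAut_hom (h : Thm44Hyp S₁ S₂) (A : S₁.C) (σ : Aut (S₁.base.obj A)) :
    (h.transportBaseAut A σ).hom = (h.cmp A).inv ≫ h.Ψbs.functor.map σ.hom ≫ (h.cmp A).hom := rfl

/-- COMPATIBILITY of the two transports with `Base`: `Base₂(Ψ τ) = transportBaseAut (Base₁ τ)` for
`τ ∈ Aut_{C₁}(A)` — the square "`Aut_{C₁}(A) → Aut_{D₁}(A^bs)` / `Aut_{C₂}(Ψ A) → Aut_{D₂}((Ψ A)^bs)`"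
commutes. [cite: MochizukiEtTh2009, Thm 4.4 p.94] -/
theorem Thm44Hyp.autBase_mapAut (h : Thm44Hyp S₁ S₂) (A : S₁.C) (τ : Aut A) :
    S₂.autBase (h.Ψ.functor.obj A) (h.Ψ.functor.mapAut A τ) = h.transportBaseAut A (S₁.autBase A τ) := by
  apply Aut.ext
  rw [h.transportBaseAut_hom]
  exact h.base_map_Ψ_cmp τ.hom

/-! ### T44-L03/L04: the [FrdI] Thm 3.4 / Cor 5.7 inputs at `(C₁, C₂, Ψ)` (p.94 l.−2 – p.95 l.1) -/

/-- **T44-L03** (p.94 l.−2 – p.95 l.1): "`Ψ` preserves pre-steps, morphisms of Frobenius type, Frobenius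
degrees, isometries … [cf. [FrdI], Theorem 3.4, (ii), (iii)]" — the clauses not transported by `Ψ^bs` alone
(Frobenius degrees, isometries, Frobenius type) plus pull-back morphisms (Thm 3.4 (iii)); pre-steps then follow
(`isPreStep_map`).  [FrdI] Thm 3.4 INPUT at the tempered Frobenioids `C₁, C₂` (standard, isotropic, not
group-like, slim bases: Thm 3.7 (i)(ii), Rmk 3.7.2, p.94 l.−5/−4). [cite: MochizukiEtTh2009, Thm 4.4 p.95] -/
def Thm44Hyp.PreservesFrobeniusStructure (h : Thm44Hyp S₁ S₂) : Prop :=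
  (∀ ⦃A B : S₁.C⦄ (φ : A ⟶ B), S₂.degFr (h.Ψ.functor.map φ) = S₁.degFr φ) ∧
  (∀ ⦃A B : S₁.C⦄ (φ : A ⟶ B), S₁.IsIsometry φ → S₂.IsIsometry (h.Ψ.functor.map φ)) ∧
  (∀ ⦃A B : S₁.C⦄ (φ : A ⟶ B), S₁.IsFrobeniusType φ → S₂.IsFrobeniusType (h.Ψ.functor.map φ)) ∧
  (∀ ⦃A B : S₁.C⦄ (φ : A ⟶ B), S₁.IsPullback φ → S₂.IsPullback (h.Ψ.functor.map φ))

/-- From T44-L03: `Ψ` preserves linear morphisms (`deg_Fr = 1`). [cite: MochizukiEtTh2009, Thm 4.4 p.95] -/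
theorem Thm44Hyp.isLinear_map (h : Thm44Hyp S₁ S₂) (h3 : h.PreservesFrobeniusStructure) {A B : S₁.C}
    {φ : A ⟶ B} (hφ : S₁.IsLinear φ) : S₂.IsLinear (h.Ψ.functor.map φ) := by
  have e : S₁.degFr φ = 1 := hφ
  show S₂.degFr (h.Ψ.functor.map φ) = 1
  rw [h3.1 φ, e]

/-- From T44-L03 and `Ψ^bs`: `Ψ` preserves pre-steps (linear base-isomorphisms).
[cite: MochizukiEtTh2009, Thm 4.4 p.95] -/
theorem Thm44Hyp.isPreStep_map (h : Thm44Hyp S₁ S₂) (h3 : h.PreservesFrobeniusStructure) {A B : S₁.C}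
    {φ : A ⟶ B} (hφ : S₁.IsPreStep φ) : S₂.IsPreStep (h.Ψ.functor.map φ) :=
  ⟨h.isLinear_map h3 hφ.1, h.isBaseIso_map hφ.2⟩

/-! ### T44-L05: `Ψ` preserves Frobenius-trivial objects (p.95 ll.1–2) — PROVED from T44-L03 -/

/-- **T44-L05** (p.95 ll.1–2): "In particular, [cf. also the existence of `Ψ^bs`] `Ψ` preserves
Frobenius-trivial objects." [cite: MochizukiEtTh2009, Thm 4.4 p.95] -/
def Thm44Hyp.PreservesFrobeniusTrivial (h : Thm44Hyp S₁ S₂) : Prop :=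
  ∀ A : S₁.C, S₁.IsFrobeniusTrivial A → S₂.IsFrobeniusTrivial (h.Ψ.functor.obj A)

/-- T44-L05 ⇐ T44-L03 + `Ψ^bs`: push the section `ζ : ℕ_{≥1} → End(A)` of `deg_Fr` forward along `Ψ`
(Frobenius degrees and Frobenius type by T44-L03, base-identity by `isBaseIdentity_map`).
[cite: MochizukiEtTh2009, Thm 4.4 p.95] -/
theorem Thm44Hyp.preservesFrobeniusTrivial_of (h : Thm44Hyp S₁ S₂) (h3 : h.PreservesFrobeniusStructure) :
    h.PreservesFrobeniusTrivial := by
  intro A hA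
  obtain ⟨ζ, hζ⟩ := hA
  refine ⟨(h.Ψ.functor.mapEnd A).comp ζ, fun n => ?_⟩
  obtain ⟨hdeg, hbi, hft⟩ := hζ n
  exact ⟨(h3.1 (ζ n)).trans hdeg, h.isBaseIdentity_map hbi, h3.2.2.1 _ hft⟩

/-! ### T44-L06/L07: (i), clause 1 — `Ψ` maps isomorphs of `A_{⊙,1}` to isomorphs of `A_{⊙,2}` (p.95 ll.2–5) -/

/-- **T44-L07** (= Thm 4.4 (i), clause 1; proof p.95 ll.2–5): "`Ψ` maps isomorphs of `A_{⊙,1}` to isomorphs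
of `A_{⊙,2}`". [cite: MochizukiEtTh2009, Thm 4.4 p.94] -/
def Thm44Hyp.MapsAodotIsomorphs (h : Thm44Hyp S₁ S₂) : Prop :=
  ∀ A : S₁.C, IsIsomorph A S₁.Aodot → IsIsomorph (h.Ψ.functor.obj A) S₂.Aodot

/-- T44-L07 ⇐ T44-L05 (at `A_{⊙,1}`) + T44-L06 + `Ψ^bs(A_{⊙,1}^bs) ≅ A_{⊙,2}^bs` (p.95 ll.2–5: "Since the
Frobenioid determined by the Frobenius-trivial objects of `C_i` is of base-trivial type [cf. [FrdI], Theorem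
5.1, (iii)], these observations … imply the portion of assertion (i) concerning `Ψ`").  T44-L06 = the tree's
PROVED `PreFrobenioid.thm51iii_iso_of_baseIso`; "isotropic" = Thm 3.7 (i) `thm37_i_isotropic_holds` (PROVED);
"`C₂` is a Frobenioid" ([FrdI] Thm 5.2 (ii)) is `hF₂`. [cite: MochizukiEtTh2009, Thm 4.4 p.95] -/
theorem Thm44Hyp.mapsAodotIsomorphs_of (h : Thm44Hyp S₁ S₂) (hF₂ : PreFrobenioid.IsFrobenioid S₂.F)
    (h5 : S₂.IsFrobeniusTrivial (h.Ψ.functor.obj S₁.Aodot)) : h.MapsAodotIsomorphs := by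
  intro A hA
  refine IsIsomorph.trans ⟨h.Ψ.functor.mapIso hA.some⟩ ?_
  have hbi : PreFrobenioid.BaseIsomorphic S₂.F (h.Ψ.functor.obj S₁.Aodot) S₂.Aodot :=
    ⟨(h.cmp S₁.Aodot).symm ≪≫ h.mapsAodot.some⟩
  exact PreFrobenioid.thm51iii_iso_of_baseIso S₂.F hF₂ (TemperedFrobenioid.thm37_i_isotropic_holds S₂.tf)
    _ _ h5 S₂.isFrobeniusTrivial_Aodot hbi

/-! ### T44-L09/L09c: "the portion of (i) concerning `Ψ^bs`" — the [SemiAnbd] input (p.95 ll.5–6) -/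

/-- **T44-L09** (= (i) clause 3; proof p.95 ll.5–6 "follows immediately from the theory of [quasi-]temperoids
[cf. [SemiAnbd], Proposition 3.2; Theorem A.4]"): "`Ψ^bs` induces an isomorphism `H_{⊙,1} ≅ H_{⊙,2}` … well-defined
up to composition with inner automorphisms of `Π^tp_{X_i}`" — an isomorphism of topological groups
`Π^tp_{X₁} ≅ Π^tp_{X₂}` carrying `H_{⊙,1}` onto `H_{⊙,2}` (the one `Ψ^bs` arises from, unique up to inner
automorphisms).  [SemiAnbd] Prop 3.2 / Thm A.4 INPUT (L3). [cite: MochizukiEtTh2009, Thm 4.4 p.94] -/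
def Thm44Hyp.HodotCompatible (_h : Thm44Hyp S₁ S₂) : Prop :=
  ∃ θ : X₁.Pi ≃ₜ* X₂.Pi, S₁.Hodot.map θ.toMulEquiv.toMonoidHom = S₂.Hodot

/-- **T44-L09c** (the form of "`Ψ^bs` induces `H_{⊙,1} ≅ H_{⊙,2}`" that (i) clause 2 and (iii) consume): for
Galois `A ∈ Ob(C₁)`, `Ψ(A)` is Galois and `Aut_{D₁}(A^bs) ≅ Aut_{D₂}((Ψ A)^bs)` (induced by `Ψ^bs`) carries
`H_A^bs` (image of `H_{⊙,1}`, Def 4.1 (ii)) onto `H_{Ψ A}^bs` — the Galois surjections `Π^tp_{X_i} ↠ Aut(A^bs)`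
are compatible with the isomorphism of T44-L09.  [SemiAnbd] INPUT (L3). [cite: MochizukiEtTh2009, Thm 4.4 p.94] -/
def Thm44Hyp.GaloisCompatible (h : Thm44Hyp S₁ S₂) : Prop :=
  ∀ (A : S₁.C) (hA : S₁.IsGalois A), ∃ hA' : S₂.IsGalois (h.Ψ.functor.obj A),
    (S₁.HAbs A hA).map (h.transportBaseAut A) = S₂.HAbs (h.Ψ.functor.obj A) hA'

/-! ### T44-L08: (i), clause 2 — `Ψ` maps `H_{⊙,1}`-ample objects to `H_{⊙,2}`-ample objects — PROVED from L09c -/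

/-- **T44-L08** (= Thm 4.4 (i), clause 2): "`Ψ` maps … `H_{⊙,1}`-ample objects to `H_{⊙,2}`-ample objects".
[cite: MochizukiEtTh2009, Thm 4.4 p.94] -/
def Thm44Hyp.PreservesAmple (h : Thm44Hyp S₁ S₂) : Prop :=
  ∀ A : S₁.C, S₁.IsAmple A → S₂.IsAmple (h.Ψ.functor.obj A)

/-- T44-L08 ⇐ T44-L09c + `Base ∘ Ψ ≅ Ψ^bs ∘ Base`: an element of `H_{Ψ A}^bs` is the transport of an element
of `H_A^bs`, which lifts to `Aut_{C₁}(A)` (`A` ample); its image under `Ψ` is the required lift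
(`autBase_mapAut`). [cite: MochizukiEtTh2009, Thm 4.4 p.95] -/
theorem Thm44Hyp.preservesAmple_of (h : Thm44Hyp S₁ S₂) (h9 : h.GaloisCompatible) : h.PreservesAmple := by
  intro A hA
  obtain ⟨hA', hmap⟩ := h9 A hA.isGalois
  refine ⟨hA', ?_⟩
  intro σ hσ
  rw [← hmap] at hσ
  obtain ⟨σ₁, hσ₁, rfl⟩ := Subgroup.mem_map.1 hσ
  obtain ⟨τ, hτ⟩ := hA.surj hσ₁
  exact ⟨h.Ψ.functor.mapAut A τ, by rw [h.autBase_mapAut, hτ]; rfl⟩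

/-! ### (i) assembled -/

/-- **Thm 4.4 (i) ASSEMBLED** from its three sub-nodes T44-L07, T44-L08, T44-L09 (clause 3 of `Thm44_i`,
`Nonempty (H_{⊙,1} ≃* H_{⊙,2})`, is the restriction of the isomorphism of T44-L09).
[cite: MochizukiEtTh2009, Thm 4.4 p.94] -/
theorem Thm44Hyp.thm44_i_of (h : Thm44Hyp S₁ S₂) (h7 : h.MapsAodotIsomorphs) (h8 : h.PreservesAmple)
    (h9 : h.HodotCompatible) : Thm44_i h := by
  refine ⟨h7, h8, ?_⟩
  obtain ⟨θ, hθ⟩ := h9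
  exact ⟨(θ.toMulEquiv.subgroupMap S₁.Hodot).trans (MulEquiv.subgroupCongr hθ)⟩

/-- **Thm 4.4 (i) from the printed proof's inputs**: "`C₂` is a Frobenioid" ([FrdI] Thm 5.2 (ii)), T44-L03
([FrdI] Thm 3.4 (ii)(iii) at `Ψ`), T44-L09c and T44-L09 ([SemiAnbd] Prop 3.2 / Thm A.4 at `Ψ^bs`).
[cite: MochizukiEtTh2009, Thm 4.4 p.95] -/
theorem Thm44Hyp.thm44_i_of_inputs (h : Thm44Hyp S₁ S₂) (hF₂ : PreFrobenioid.IsFrobenioid S₂.F)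
    (h3 : h.PreservesFrobeniusStructure) (h9c : h.GaloisCompatible) (h9 : h.HodotCompatible) :
    Thm44_i h :=
  h.thm44_i_of
    (h.mapsAodotIsomorphs_of hF₂ (h.preservesFrobeniusTrivial_of h3 _ S₁.isFrobeniusTrivial_Aodot))
    (h.preservesAmple_of h9c) h9

/-! ### (ii): T44-L10 `Ψ^birat` ([FrdI] Cor 4.10), T44-L12 disjoint supports ([FrdI] Thm 4.2 (ii)), left fraction-pairs, T44-L14 roots -/

/-- **T44-L10** (p.95 ll.7–8 "The existence of `Ψ^birat` follows from [FrdI], Corollary 4.10"): the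
identification `ψ_A : O^×(A^birat) ≅ O^×(Ψ(A)^birat)` of the 1-compatible `Ψ^birat` is compatible with (a)
restriction along pre-steps, (b) the fractions `s'·(s'')⁻¹`, (c) the `Aut`-actions.  [FrdI] Cor 4.10 INPUT
(proof arguments on the `C₂` side quantified universally). [cite: MochizukiEtTh2009, Thm 4.4 p.95] -/
structure Thm44Hyp.BiratCompatible (h : Thm44Hyp S₁ S₂)
    (ψ : ∀ A : S₁.C, S₁.biratUnits A ≃* S₂.biratUnits (h.Ψ.functor.obj A)) : Prop where
  /-- (a) `ψ_B (f|_B) = (ψ_A f)|_{Ψ B}` along a pre-step `s : A → B` -/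
  restrict : ∀ {A B : S₁.C} (s : A ⟶ B) (hs : S₁.IsPreStep s) (ks : S₂.IsPreStep (h.Ψ.functor.map s))
    (f : S₁.biratUnits A), ψ B (S₁.restrictAlong s hs f) = S₂.restrictAlong (h.Ψ.functor.map s) ks (ψ A f)
  /-- (b) `ψ_A (s'·(s'')⁻¹) = Ψ(s')·Ψ(s'')⁻¹` -/
  frac : ∀ {A B : S₁.C} (s' s'' : A ⟶ B) (h' : S₁.IsPreStep s') (h'' : S₁.IsPreStep s'')
    (hb : PreFrobenioid.BaseEquivalent S₁.F s' s'') (k' : S₂.IsPreStep (h.Ψ.functor.map s'))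
    (k'' : S₂.IsPreStep (h.Ψ.functor.map s''))
    (kb : PreFrobenioid.BaseEquivalent S₂.F (h.Ψ.functor.map s') (h.Ψ.functor.map s'')),
    S₂.fracOf (h.Ψ.functor.map s') (h.Ψ.functor.map s'') k' k'' kb = ψ A (S₁.fracOf s' s'' h' h'' hb)
  /-- (c) `ψ_A (σ · f) = Ψ(σ) · ψ_A f` for `σ ∈ Aut_{C₁}(A)` -/
  aut : ∀ {A : S₁.C} (σ : Aut A) (f : S₁.biratUnits A),
    ψ A (S₁.biratAut A σ f) = S₂.biratAut (h.Ψ.functor.obj A) (h.Ψ.functor.mapAut A σ) (ψ A f)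

/-- **T44-L12** (p.95 ll.10–12): "it follows immediately from the category-theoreticity of sets of primes
given in [FrdI], Theorem 4.2, (ii), that `Ψ` preserves base-equivalent … pairs of pre-steps whose `Div(−)`'s
have disjoint supports" — the disjointness clause ([FrdI] Thm 4.2 (ii) INPUT at `Ψ`; base-equivalence is
transported by `Ψ^bs`, `Discharge/Sec4Thm44ii`). [cite: MochizukiEtTh2009, Thm 4.4 p.95] -/
def Thm44Hyp.PreservesDisjointSupports (h : Thm44Hyp S₁ S₂) : Prop :=
  ∀ ⦃A B : S₁.C⦄ (s' s'' : A ⟶ B), S₁.DisjointSupports (S₁.div s') (S₁.div s'') →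
    S₂.DisjointSupports (S₂.div (h.Ψ.functor.map s')) (S₂.div (h.Ψ.functor.map s''))

/-- **Thm 4.4 (ii), left-fraction-pair clause** (p.94: "`Ψ` preserves fraction-pairs, right fraction-pairs,
and left fraction-pairs"; Def 4.1 (i): `(s', s'')` is a left fraction-pair for `f|_B`): the image of a
fraction-pair for `f` is a fraction-pair for `ψ f` whose restriction `(ψ f)|_{Ψ B}` is `ψ (f|_B)` — the clause
of (ii) not rendered by `Thm44_ii`. [cite: MochizukiEtTh2009, Thm 4.4 p.94] -/
def Thm44_ii_left (h : Thm44Hyp S₁ S₂)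
    (ψ : ∀ A : S₁.C, S₁.biratUnits A ≃* S₂.biratUnits (h.Ψ.functor.obj A)) : Prop :=
  ∀ {A B : S₁.C} (f : S₁.biratUnits A) (P : S₁.FractionPair f B),
    ∃ Q : S₂.FractionPair (ψ A f) (h.Ψ.functor.obj B),
      Q.num = h.Ψ.functor.map P.num ∧ Q.den = h.Ψ.functor.map P.den ∧ Q.restrict = ψ B P.restrict

/-- **T44-L04** (p.95 l.1 and l.19: "`Ψ` preserves … base-Frobenius pairs [cf. [FrdI], Corollary 5.7, (i),
(iv)]"; "`Ψ` preserves base-Frobenius pairs of Frobenius-trivial objects"): the data `(G, α', α'')` arising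
from a base-Frobenius pair ([FrdI] Def 2.7 (iii)) are carried by `Ψ` to data arising from a base-Frobenius
pair.  [FrdI] Cor 5.7 INPUT at `Ψ`. [cite: MochizukiEtTh2009, Thm 4.4 p.95] -/
def Thm44Hyp.PreservesBaseFrobeniusPairs (h : Thm44Hyp S₁ S₂) : Prop :=
  ∀ ⦃A B : S₁.C⦄ (G : Subgroup (Aut A)) (α₂ : A ⟶ A) (α₁ : A ⟶ B),
    S₁.ArisesFromBaseFrobeniusPair G α₂ α₁ →
      S₂.ArisesFromBaseFrobeniusPair (G.map (h.Ψ.functor.mapAut A)) (h.Ψ.functor.map α₂) (h.Ψ.functor.map α₁)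

/-- **T44-L04b** (Def 4.1 (iv) transported): `Ψ` carries the data "of base-Frobenius type" of `α` to such
data for `Ψ(α)`, field by field (`G ↦ Ψ(G)`, `α' ↦ Ψ(α')`, `α'' ↦ Ψ(α'')`).  Sub-node assembled from T44-L03
((c) Frobenius type, (d) pull-back, the Frobenius degree `N`), T44-L04 ((e)), T44-L05 ((a)
Frobenius-trivial), T44-L09c ((a) Galois, (b) `G ≅ Gal(A^bs/B^bs)` transported through `Ψ^bs`) and [FrdI]
Thm 3.4 (iv) "`Ψ` preserves `O^×(−)`" ((a) `μ_N`-saturation); the field-wise derivation is a separate row.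
[cite: MochizukiEtTh2009, Thm 4.4 p.95] -/
def Thm44Hyp.PreservesBaseFrobeniusTypeData (h : Thm44Hyp S₁ S₂) : Prop :=
  ∀ ⦃A B : S₁.C⦄ (α : A ⟶ B) (d : S₁.BaseFrobeniusTypeData α),
    ∃ d' : S₂.BaseFrobeniusTypeData (h.Ψ.functor.map α),
      d'.G = d.G.map (h.Ψ.functor.mapAut A) ∧ d'.α₂ = h.Ψ.functor.map d.α₂ ∧ d'.α₁ = h.Ψ.functor.map d.α₁

/-- **T44-L14** (= Thm 4.4 (ii), last clause; proof p.95 ll.12–16, used again at l.19 for (iv)): "`Ψ` maps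
`N`-th roots of fraction-pairs with domain isomorphic to `A_{⊙,1}` to `N`-th roots of fraction-pairs with
domain isomorphic to `A_{⊙,2}`" — in the shape `Thm44_iv` binds: the image root `R₂` of the image
fraction-pair `Q`, with identifications `Ψ(A_N) ≅ A_{2,N}`, `Ψ(B_N) ≅ B_{2,N}` intertwining `s'_N, s''_N, α, β`.
[cite: MochizukiEtTh2009, Thm 4.4 p.94] -/
def Thm44Hyp.PreservesNthRoots (h : Thm44Hyp S₁ S₂)
    (ψ : ∀ A : S₁.C, S₁.biratUnits A ≃* S₂.biratUnits (h.Ψ.functor.obj A))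
    (pullFrac₁ : ∀ {A A' : S₁.C} (_ : A' ⟶ A), S₁.biratUnits A → S₁.biratUnits A')
    (pullFrac₂ : ∀ {A A' : S₂.C} (_ : A' ⟶ A), S₂.biratUnits A → S₂.biratUnits A') : Prop :=
  ∀ {A B : S₁.C} (f : S₁.biratUnits A) (P : S₁.FractionPair f B) (N : ℕ+)
    (R : S₁.NthRoot f P N pullFrac₁) (Q : S₂.FractionPair (ψ A f) (h.Ψ.functor.obj B)),
    IsIsomorph A S₁.Aodot → Q.num = h.Ψ.functor.map P.num → Q.den = h.Ψ.functor.map P.den →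
      ∃ (R₂ : S₂.NthRoot (ψ A f) Q N pullFrac₂) (eAN : h.Ψ.functor.obj R.AN ≅ R₂.AN)
        (eB : h.Ψ.functor.obj R.BN ≅ R₂.BN),
        eAN.inv ≫ h.Ψ.functor.map R.pair.num ≫ eB.hom = R₂.pair.num ∧
        eAN.inv ≫ h.Ψ.functor.map R.pair.den ≫ eB.hom = R₂.pair.den ∧
        eAN.hom ≫ R₂.α = h.Ψ.functor.map R.α ∧ eB.hom ≫ R₂.β = h.Ψ.functor.map R.β

/-! ### (iii): saturation — T44-L15a/L15b and the two directions of `Thm44_iii` (p.95 ll.12–18) -/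

/-- **T44-L15a** ("Suppose that `A₁ ↦ A₂` via `Ψ`, and that `f₁ ↦ f₂` via `Ψ^birat`", p.94 (iii): then `f₂` is
fixed by `H_{A₂}` when `f₁` is fixed by `H_{A₁}`). [cite: MochizukiEtTh2009, Thm 4.4 p.94] -/
def Thm44Hyp.PreservesFixedByHA (h : Thm44Hyp S₁ S₂)
    (ψ : ∀ A : S₁.C, S₁.biratUnits A ≃* S₂.biratUnits (h.Ψ.functor.obj A)) : Prop :=
  ∀ (A : S₁.C) (hA : S₁.IsGalois A) (hA' : S₂.IsGalois (h.Ψ.functor.obj A)) (f : S₁.biratUnits A),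
    S₁.IsFixedByHA A hA f → S₂.IsFixedByHA (h.Ψ.functor.obj A) hA' (ψ A f)

/-- **T44-L15b** (p.95 ll.14–16: "the «manifestly category-theoretic nature» of
«`(N, H^{bs-fld}_{⊙,i})`-saturation» [cf. [FrdII], Definition 2.2, (ii); [AbsAnab], Lemma 1.3.8]"): for a
Frobenius-trivial `A'' ∈ Ob(C₁)` and any `B'' ≅ Ψ(A'')`, `A''` is `(N, H^{bs-fld}_{⊙,1})`-saturated in
`C₁^{bs-fld}` iff `B''` is `(N, H^{bs-fld}_{⊙,2})`-saturated in `C₂^{bs-fld}`.  [FrdII] Def 2.2 (ii) /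
[AbsAnab] Lem 1.3.8 INPUT (L1/L4). [cite: MochizukiEtTh2009, Thm 4.4 p.95] -/
def Thm44Hyp.PreservesNHSaturatedBsFld (h : Thm44Hyp S₁ S₂) : Prop :=
  ∀ (A'' : S₁.C) (B'' : S₂.C) (N : ℕ+), S₁.IsFrobeniusTrivial A'' → IsIsomorph (h.Ψ.functor.obj A'') B'' →
    (S₁.IsNHSaturatedBsFld S₁.HodotBsFld A'' N ↔ S₂.IsNHSaturatedBsFld S₂.HodotBsFld B'' N)

/-- **T44-L15 (⇒)**: `(N, H_{⊙,1}, f)`-saturation of `A` implies `(N, H_{⊙,2}, ψ f)`-saturation of `Ψ(A)`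
(under the ampleness/fixedness hypotheses of (iii), v5). [cite: MochizukiEtTh2009, Thm 4.4 p.94] -/
def Thm44Hyp.PreservesSaturated (h : Thm44Hyp S₁ S₂)
    (ψ : ∀ A : S₁.C, S₁.biratUnits A ≃* S₂.biratUnits (h.Ψ.functor.obj A)) : Prop :=
  ∀ (A : S₁.C) (N : ℕ+) (f : S₁.biratUnits A) (hA₂ : S₂.IsAmple (h.Ψ.functor.obj A)),
    S₂.IsFixedByHA (h.Ψ.functor.obj A) hA₂.isGalois (ψ A f) →
      S₁.IsSaturated A N f → S₂.IsSaturated (h.Ψ.functor.obj A) N (ψ A f)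

/-- **T44-L15 (⇐)**: the converse transport (the statement T44-L15 (⇒) for `Ψ⁻¹`, moved along
`Ψ ∘ Ψ⁻¹ ≅ id`; it needs the [FrdI] Thm 3.4 inputs for `Ψ⁻¹`). [cite: MochizukiEtTh2009, Thm 4.4 p.94] -/
def Thm44Hyp.ReflectsSaturated (h : Thm44Hyp S₁ S₂)
    (ψ : ∀ A : S₁.C, S₁.biratUnits A ≃* S₂.biratUnits (h.Ψ.functor.obj A)) : Prop :=
  ∀ (A : S₁.C) (N : ℕ+) (f : S₁.biratUnits A) (hA₁ : S₁.IsAmple A),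
    S₁.IsFixedByHA A hA₁.isGalois f → S₂.IsSaturated (h.Ψ.functor.obj A) N (ψ A f) → S₁.IsSaturated A N f

end BiKummerSetting

end Literature.AnabelianGeometry.EtaleTheta
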